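import Summits.CriticalPhenomena.PercolationContinuityZ3.Theorems.PercNearOneGluingNoHeavyQuantFarSunGame
import Mathlib.Data.Nat.Cast.Field
import Mathlib.Tactic.FieldSimp
import Mathlib.Tactic.Ring
import Mathlib.Tactic.Linarith
import Mathlib.Tactic.Positivity
import HarnessLib

/-!
# FAR beyond trees: SOUNDNESS of the delay-2 budget game — the certificate lower-bounds the mean flank payoff of every word

builds on p205010 (kernel theorem, internal audit signed; external expert review pending)

Support file (`--supports stmt-CriticalPhenomena-4575`), seat `prim-cert-1` (gen 39); memo `prim-cert-1/FROM-prim-cert-1-g39-VERTEX-GAME.md` §3, §4 (L3).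
Continues `…QuantFarSunGame` (the flank automaton `FSt`, its mean payoff `autoE`, and the game table `GameSpec.gameLayer` / `gameCert`).

* `GameSpec.lookup_tabulate`, `gameLayer_zero`, `gameLayer_succ` — the memoised table satisfies the Bellman recursion literally.
* **`GameSpec.gameLayer_sound`** — for every word `i₁ … i_n` over the alphabet (weights summing to `B ≤ NB`), every capped state `s` and pending letters
  `a, b`: layer `n` at `(s,a,b,B)` is `some v` with `v ≤ q^(n+2)·Lpay·autoE s (g_a, g_b, g_{i₁}, …, g_{i_n})` (induction on the word: the adversary may
  always play the word's next letter; base = exact resolution of the two pending letters, `payNum = Lpay·pay`).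
* **`GameSpec.autoE_nonneg_of_gameCert`** — `gameCert NB K Bs = true` ⇒ `0 ≤ autoE start (g_{i₁}, …, g_{i_K})` for every word of length `K ≥ 2` with weight in `Bs`.
Elementary [this work]; no definitions; no sorries; standard axioms.
-/

namespace Summit.CriticalPhenomena.PercolationContinuityZ3.Theorems.HairyCycle

open Finset

namespace GameSpec

/-! ## Soundness: the game value lower-bounds the mean payoff of every word -/

section Sound

variable {P : GameSpec}

/-- `(y + x·m)/m = x` for `y < m`. -/
theorem pair_div {x y m : ℕ} (hy : y < m) : (y + x * m) / m = x := by
  have hm : 0 < m := by omega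
  rw [Nat.add_mul_div_right _ _ hm, Nat.div_eq_of_lt hy, zero_add]

/-- `(y + x·m) % m = y` for `y < m`. -/
theorem pair_mod {x y m : ℕ} (hy : y < m) : (y + x * m) % m = y := by
  rw [Nat.add_mul_mod_self_right, Nat.mod_eq_of_lt hy]

/-- `y + x·m < X·m` for `x < X`, `y < m`. -/
theorem pair_lt {x y m X : ℕ} (hx : x < X) (hy : y < m) : y + x * m < X * m := by
  calc y + x * m < m + x * m := by omega
    _ = (x + 1) * m := by ring
    _ ≤ X * m := Nat.mul_le_mul_right _ (by omega)

/-- Decoding an encoded in-range index gives it back. [this work] -/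
theorem dIdx_eIdx {NB : ℕ} {s : FSt} {a b B : ℕ} (h : P.InRange NB s a b B) :
    P.dIdx NB (P.eIdx NB s a b B) = (s, a, b, B) := by
  obtain ⟨hA, hNc, hNp, hCf, ha, hb, hB⟩ := h
  cases s with
  | mk A Nc Np Cf =>
    simp only at hA hNc hNp hCf
    simp only [GameSpec.dIdx, GameSpec.eIdx, GameSpec.sIdx, pair_div (Nat.lt_succ_of_le hB), pair_mod (Nat.lt_succ_of_le hB),
      pair_div hb, pair_mod hb, pair_div ha, pair_mod ha, pair_div (Nat.lt_succ_of_le hCf), pair_mod (Nat.lt_succ_of_le hCf),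
      pair_div (Nat.lt_succ_of_le hNp), pair_mod (Nat.lt_succ_of_le hNp), pair_div (Nat.lt_succ_of_le hNc),
      pair_mod (Nat.lt_succ_of_le hNc)]

/-- An encoded in-range index is inside the table. [this work] -/
theorem eIdx_lt {NB : ℕ} {s : FSt} {a b B : ℕ} (h : P.InRange NB s a b B) : P.eIdx NB s a b B < P.tSize NB := by
  obtain ⟨hA, hNc, hNp, hCf, ha, hb, hB⟩ := h
  unfold GameSpec.eIdx GameSpec.tSize GameSpec.sIdx GameSpec.nS
  have h1 : s.Nc + s.A * (P.C + 1) < (P.Amax + 1) * (P.C + 1) := pair_lt (Nat.lt_succ_of_le hA) (Nat.lt_succ_of_le hNc)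
  have h2 := pair_lt h1 (Nat.lt_succ_of_le hNp)
  have h3 := pair_lt h2 (Nat.lt_succ_of_le hCf)
  have h4 := pair_lt h3 ha
  have h5 := pair_lt h4 hb
  exact pair_lt h5 (Nat.lt_succ_of_le hB)

/-- Reading back a tabulated layer. [this work] -/
theorem lookup_tabulate {NB : ℕ} (F : FSt → ℕ → ℕ → ℕ → Option ℤ) {s : FSt} {a b B : ℕ} (h : P.InRange NB s a b B) :
    P.lookup NB (P.tabulate NB F) s a b B = F s a b B := by
  unfold GameSpec.lookup GameSpec.tabulate
  rw [if_pos h, Array.getElem?_ofFn, dif_pos (eIdx_lt h)]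
  simp only [Option.getD_some, dIdx_eIdx h]

/-- One more iteration is one more Bellman step on top. [this work] -/
theorem gameIter_succ (NB n : ℕ) (acc : Array (Option ℤ)) :
    P.gameIter NB (n + 1) acc = P.tabulate NB (P.stepVal (P.lookup NB (P.gameIter NB n acc))) := by
  induction n generalizing acc with
  | zero => rfl
  | succ n ih =>
    rw [GameSpec.gameIter]
    exact ih _

/-- Layer `0` is the base layer. [this work] -/
theorem gameLayer_zero {NB : ℕ} {s : FSt} {a b B : ℕ} (h : P.InRange NB s a b B) :
    P.gameLayer NB 0 s a b B = P.baseVal s a b B := by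
  unfold GameSpec.gameLayer GameSpec.gameArr
  rw [GameSpec.gameIter]
  exact lookup_tabulate _ h

/-- Layer `n+1` is the Bellman step applied to layer `n`. [this work] -/
theorem gameLayer_succ {NB n : ℕ} {s : FSt} {a b B : ℕ} (h : P.InRange NB s a b B) :
    P.gameLayer NB (n + 1) s a b B = P.stepVal (P.gameLayer NB n) s a b B := by
  unfold GameSpec.gameLayer GameSpec.gameArr
  rw [gameIter_succ, lookup_tabulate _ h]

/-- `omin x (some t)` is `some` of something `≤ t`, and `omin` never exceeds its first argument. [this work] -/
theorem omin_some_right (x : Option ℤ) (t : ℤ) : ∃ v, GameSpec.omin x (some t) = some v ∧ v ≤ t := by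
  cases x with
  | none => exact ⟨t, rfl, le_rfl⟩
  | some u => exact ⟨min u t, rfl, min_le_right _ _⟩

/-- `omin (some v) y` is `some` of something `≤ v`. -/
theorem omin_some_left (v : ℤ) (y : Option ℤ) : ∃ v', GameSpec.omin (some v) y = some v' ∧ v' ≤ v := by
  cases y with
  | none => exact ⟨v, rfl, le_rfl⟩
  | some u => exact ⟨min v u, rfl, min_le_left _ _⟩

/-- A fold of `omin`-updates starting from `some v` stays `some` and never increases. [this work] -/
theorem foldl_omin_mono (g : ℕ → Option ℤ) (c : ℕ → Prop) [DecidablePred c] (l : List ℕ) (v : ℤ) :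
    ∃ v', l.foldl (fun acc i => if c i then GameSpec.omin acc (g i) else acc) (some v) = some v' ∧ v' ≤ v := by
  induction l generalizing v with
  | nil => exact ⟨v, rfl, le_rfl⟩
  | cons j l ih =>
    rw [List.foldl_cons]
    by_cases hc : c j
    · rw [if_pos hc]
      obtain ⟨v₁, h₁, hv₁⟩ := omin_some_left v (g j)
      rw [h₁]
      obtain ⟨v', h', hv'⟩ := ih v₁
      exact ⟨v', h', hv'.trans hv₁⟩
    · rw [if_neg hc]
      exact ih v

/-- A fold of `omin`-updates is `some` of something `≤ t` as soon as one admissible term is `some t`. [this work] -/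
theorem foldl_omin_le (g : ℕ → Option ℤ) (c : ℕ → Prop) [DecidablePred c] (l : List ℕ) (init : Option ℤ) {i : ℕ} (hi : i ∈ l)
    (hci : c i) {t : ℤ} (ht : g i = some t) :
    ∃ v, l.foldl (fun acc i => if c i then GameSpec.omin acc (g i) else acc) init = some v ∧ v ≤ t := by
  induction l generalizing init with
  | nil => exact absurd hi List.not_mem_nil
  | cons j l ih =>
    rw [List.foldl_cons]
    rcases List.mem_cons.1 hi with rfl | hil
    · rw [if_pos hci, ht]
      obtain ⟨v₁, h₁, hv₁⟩ := omin_some_right init t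
      rw [h₁]
      obtain ⟨v', h', hv'⟩ := foldl_omin_mono g c l v₁
      exact ⟨v', h', hv'.trans hv₁⟩
    · exact ih _ hil

/-- `op` preserves the caps. -/
theorem valid_op {Amax C Cc : ℕ} {s : FSt} (h : s.Valid Amax C Cc) : (s.op Amax Cc).Valid Amax C Cc :=
  ⟨min_le_right _ _, Nat.zero_le _, h.2.1, min_le_right _ _⟩

/-- `cl` preserves the caps. -/
theorem valid_cl {Amax C Cc : ℕ} {s : FSt} (h : s.Valid Amax C Cc) : (s.cl C).Valid Amax C Cc :=
  ⟨h.1, min_le_right _ _, h.2.2.1, h.2.2.2⟩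

/-- The integer payoff numerator is `Lpay ×` the real payoff (for any state). [this work] -/
theorem payNum_cast (W : P.WF) (s : FSt) :
    ((s.payNum P.Amax P.Kcred P.Lpay : ℤ) : ℝ) = (P.Lpay : ℝ) * s.pay P.Amax P.Kcred := by
  unfold FSt.payNum FSt.pay
  have hsub : ∀ {c d : ℕ}, 1 ≤ d → d ∣ P.Lpay → (((c * (P.Lpay / d) : ℕ) : ℤ) : ℝ) = (P.Lpay : ℝ) * ((c : ℝ) / (d : ℝ)) := by
    intro c d hd hdvd
    have hd0 : (d : ℝ) ≠ 0 := by exact_mod_cast (show d ≠ 0 by omega)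
    have e : (((c * (P.Lpay / d) : ℕ) : ℤ) : ℝ) = ((c * (P.Lpay / d) : ℕ) : ℝ) := by norm_cast
    rw [e, Nat.cast_mul, Nat.cast_div hdvd hd0]
    field_simp
  by_cases h4 : 4 ≤ s.A
  · rw [if_pos h4, if_pos h4]
    by_cases hlt : s.A < P.Amax
    · rw [if_pos hlt, if_pos hlt]
      have hd : 1 ≤ s.A - 3 := by omega
      have hdv : (s.A - 3) ∣ P.Lpay := W.dvdA (s.A - 3) hd (by omega)
      have hcast : ((s.A - 3 : ℕ) : ℝ) = (s.A : ℝ) - 3 := by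
        rw [Nat.cast_sub (by omega)]
        norm_num
      rw [Int.cast_sub, hsub hd hdv, hcast]
      split_ifs <;> push_cast <;> ring
    · rw [if_neg hlt, if_neg hlt]
      have hd : 1 ≤ P.Kcred - 3 := by have := W.Kcred4; omega
      have hcast : ((P.Kcred - 3 : ℕ) : ℝ) = (P.Kcred : ℝ) - 3 := by
        rw [Nat.cast_sub (by have := W.Kcred4; omega)]
        norm_num
      rw [Int.cast_sub, hsub hd W.dvdK, hcast]
      split_ifs <;> push_cast <;> ring
  · rw [if_neg h4, if_neg h4]
    split_ifs <;> push_cast <;> ring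

/-- Unfolding `autoE` on a nonempty word. -/
theorem autoE_cons (Amax C Cc Kcred : ℕ) (s : FSt) (p : ℝ) (ps : List ℝ) :
    autoE Amax C Cc Kcred s (p :: ps) = p * autoE Amax C Cc Kcred (s.op Amax Cc) ps + (1 - p) * autoE Amax C Cc Kcred (s.cl C) ps := rfl

/-- Unfolding `autoE` on the empty word. -/
theorem autoE_nil (Amax C Cc Kcred : ℕ) (s : FSt) : autoE Amax C Cc Kcred s [] = s.pay Amax Kcred := rfl

/-- **SOUNDNESS OF THE GAME TABLE.**  For every word `i₁ … i_n` over the alphabet with total weight `B ≤ NB`, every in-range state `s` and pending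
letters `a`, `b`: layer `n` at `(s, a, b, B)` is `some v` with `v ≤ q^(n+2) · Lpay · autoE s (g_a, g_b, g_{i₁}, …, g_{i_n})` — the adversary of the
delay-2 game may always play the fixed word. [this work] -/
theorem gameLayer_sound (W : P.WF) (NB : ℕ) :
    ∀ (n : ℕ) (word : List ℕ) (s : FSt) (a b B : ℕ), s.Valid P.Amax P.C P.Cc → a < P.nL → b < P.nL → (∀ i ∈ word, i < P.nL) →
      word.length = n → (word.map P.wOf).sum = B → B ≤ NB →
      ∃ v, P.gameLayer NB n s a b B = some v ∧
        (v : ℝ) ≤ (P.q : ℝ) ^ (n + 2) * P.Lpay * autoE P.Amax P.C P.Cc P.Kcred s (P.gOf a :: P.gOf b :: word.map P.gOf) := by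
  intro n
  induction n with
  | zero =>
    intro word s a b B hs ha hb _ hlen hsum hB
    have hw : word = [] := List.eq_nil_of_length_eq_zero hlen
    subst hw
    simp only [List.map_nil, List.sum_nil] at hsum
    subst hsum
    have hR : P.InRange NB s a b 0 := ⟨hs.1, hs.2.1, hs.2.2.1, hs.2.2.2, ha, hb, Nat.zero_le _⟩
    rw [gameLayer_zero hR]
    unfold GameSpec.baseVal
    rw [if_pos rfl]
    refine ⟨_, rfl, le_of_eq ?_⟩
    simp only [List.map_nil, autoE_cons, autoE_nil]
    have hoo := payNum_cast W ((s.op P.Amax P.Cc).op P.Amax P.Cc)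
    have hoc := payNum_cast W ((s.op P.Amax P.Cc).cl P.C)
    have hco := payNum_cast W ((s.cl P.C).op P.Amax P.Cc)
    have hcc := payNum_cast W ((s.cl P.C).cl P.C)
    unfold GameSpec.gOf
    have hq : (P.q : ℝ) ≠ 0 := by exact_mod_cast (ne_of_gt W.q_pos)
    push_cast
    rw [hoo, hoc, hco, hcc]
    field_simp
  | succ n ih =>
    intro word s a b B hs ha hb hword hlen hsum hB
    obtain ⟨i, rest, rfl⟩ : ∃ i rest, word = i :: rest := by
      cases word with
      | nil => simp at hlen
      | cons i rest => exact ⟨i, rest, rfl⟩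
    have hi : i < P.nL := hword i (List.mem_cons_self)
    have hrest : ∀ i' ∈ rest, i' < P.nL := fun i' hi' => hword i' (List.mem_cons_of_mem _ hi')
    have hlen' : rest.length = n := by simpa using hlen
    simp only [List.map_cons, List.sum_cons] at hsum
    have hwi : P.wOf i ≤ B := by omega
    have hsum' : (rest.map P.wOf).sum = B - P.wOf i := by omega
    have hR : P.InRange NB s a b B := ⟨hs.1, hs.2.1, hs.2.2.1, hs.2.2.2, ha, hb, hB⟩
    rw [gameLayer_succ hR]
    -- the two continuation values given by the induction hypothesis
    obtain ⟨u, hu, hule⟩ := ih rest (s.op P.Amax P.Cc) b i (B - P.wOf i) (valid_op hs) hb hi hrest hlen' hsum' (by omega)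
    obtain ⟨u', hu', hu'le⟩ := ih rest (s.cl P.C) b i (B - P.wOf i) (valid_cl hs) hb hi hrest hlen' hsum' (by omega)
    -- the term of letter `i` in the Bellman minimum
    set g : ℕ → Option ℤ := fun i' =>
      match P.gameLayer NB n (s.op P.Amax P.Cc) b i' (B - P.wOf i'), P.gameLayer NB n (s.cl P.C) b i' (B - P.wOf i') with
      | some x, some y => some ((P.kOf a : ℤ) * x + ((P.q : ℤ) - P.kOf a) * y)
      | _, _ => none with hg
    have hgi : g i = some ((P.kOf a : ℤ) * u + ((P.q : ℤ) - P.kOf a) * u') := by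
      simp only [hg, hu, hu']
    have hstep : P.stepVal (P.gameLayer NB n) s a b B =
        (List.range P.nL).foldl (fun acc i' => if P.wOf i' ≤ B then GameSpec.omin acc (g i') else acc) none := rfl
    rw [hstep]
    obtain ⟨v, hv, hvle⟩ := foldl_omin_le g (fun i' => P.wOf i' ≤ B) (List.range P.nL) none (List.mem_range.2 hi) hwi hgi
    refine ⟨v, hv, ?_⟩
    have hka : (P.kOf a : ℝ) ≤ P.q := by exact_mod_cast W.k_le a ha
    have hq : (P.q : ℝ) ≠ 0 := by exact_mod_cast (ne_of_gt W.q_pos)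
    have hv' : (v : ℝ) ≤ (P.kOf a : ℝ) * u + ((P.q : ℝ) - P.kOf a) * u' := by exact_mod_cast hvle
    simp only [List.map_cons]
    rw [autoE_cons]
    have h1 : (P.kOf a : ℝ) * (u : ℝ) ≤ (P.kOf a : ℝ) * ((P.q : ℝ) ^ (n + 2) * P.Lpay *
        autoE P.Amax P.C P.Cc P.Kcred (s.op P.Amax P.Cc) (P.gOf b :: P.gOf i :: rest.map P.gOf)) :=
      mul_le_mul_of_nonneg_left hule (Nat.cast_nonneg _)
    have h2 : ((P.q : ℝ) - P.kOf a) * (u' : ℝ) ≤ ((P.q : ℝ) - P.kOf a) * ((P.q : ℝ) ^ (n + 2) * P.Lpay *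
        autoE P.Amax P.C P.Cc P.Kcred (s.cl P.C) (P.gOf b :: P.gOf i :: rest.map P.gOf)) :=
      mul_le_mul_of_nonneg_left hu'le (by linarith)
    have hg' : P.gOf a = (P.kOf a : ℝ) / P.q := rfl
    rw [hg']
    calc (v : ℝ) ≤ (P.kOf a : ℝ) * u + ((P.q : ℝ) - P.kOf a) * u' := hv'
      _ ≤ _ := add_le_add h1 h2
      _ = _ := by field_simp; ring

/-- The start value of the certificate lower-bounds the layer-`(K−2)` entry of any actual first two letters. [this work] -/
theorem startOf_le {NB : ℕ} (T : Array (Option ℤ)) {B a b : ℕ} (ha : a < P.nL) (hb : b < P.nL) (hab : P.wOf a + P.wOf b ≤ B) {t : ℤ}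
    (ht : P.lookup NB T FSt.start a b (B - P.wOf a - P.wOf b) = some t) :
    ∃ v, P.startOf NB T B = some v ∧ v ≤ t := by
  unfold GameSpec.startOf
  -- inner folds are monotone and the one at `a` catches `b`
  set inner : Option ℤ → ℕ → Option ℤ := fun acc a' => (List.range P.nL).foldl (fun acc' b' =>
      if P.wOf a' + P.wOf b' ≤ B then GameSpec.omin acc' (P.lookup NB T FSt.start a' b' (B - P.wOf a' - P.wOf b')) else acc') acc with hinner
  have hmono : ∀ a' (v : ℤ), ∃ v', inner (some v) a' = some v' ∧ v' ≤ v := fun a' v =>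
    foldl_omin_mono (fun b' => P.lookup NB T FSt.start a' b' (B - P.wOf a' - P.wOf b')) (fun b' => P.wOf a' + P.wOf b' ≤ B) _ v
  have hcatch : ∀ init, ∃ v, inner init a = some v ∧ v ≤ t := fun init =>
    foldl_omin_le (fun b' => P.lookup NB T FSt.start a b' (B - P.wOf a - P.wOf b')) (fun b' => P.wOf a + P.wOf b' ≤ B) _ init
      (List.mem_range.2 hb) hab ht
  have key : ∀ (l : List ℕ) (init : Option ℤ), (a ∈ l ∨ ∃ v, init = some v ∧ v ≤ t) → ∃ v, l.foldl inner init = some v ∧ v ≤ t := by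
    intro l
    induction l with
    | nil =>
      intro init h
      rcases h with h | h
      · exact absurd h List.not_mem_nil
      · simpa using h
    | cons a' l ihl =>
      intro init h
      rw [List.foldl_cons]
      apply ihl
      rcases h with h | ⟨v, rfl, hv⟩
      · rcases List.mem_cons.1 h with rfl | h
        · exact Or.inr (hcatch init)
        · exact Or.inl h
      · obtain ⟨v', h', hv'⟩ := hmono a' v
        exact Or.inr ⟨v', h', hv'.trans hv⟩
  exact key _ none (Or.inl (List.mem_range.2 ha))

/-- **CERTIFICATE ⇒ NONNEGATIVE MEAN PAYOFF.**  If `gameCert NB K Bs = true` then for every word of length `K ≥ 2` over the alphabet whose total weight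
is in `Bs` (and `≤ NB`), the mean payoff of the flank automaton from the start state is `≥ 0`. [this work] -/
theorem autoE_nonneg_of_gameCert (W : P.WF) {NB K : ℕ} {Bs : List ℕ} (hc : P.gameCert NB K Bs = true) (hK : 2 ≤ K)
    (word : List ℕ) (hw : ∀ i ∈ word, i < P.nL) (hlen : word.length = K) (hBs : (word.map P.wOf).sum ∈ Bs)
    (hNB : (word.map P.wOf).sum ≤ NB) :
    0 ≤ autoE P.Amax P.C P.Cc P.Kcred FSt.start (word.map P.gOf) := by
  obtain ⟨a, b, rest, rfl⟩ : ∃ a b rest, word = a :: b :: rest := by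
    match word, hlen with
    | a :: b :: rest, _ => exact ⟨a, b, rest, rfl⟩
    | [], h => simp at h; omega
    | [_], h => simp at h; omega
  have ha : a < P.nL := hw a (by simp)
  have hb : b < P.nL := hw b (by simp)
  have hrest : ∀ i ∈ rest, i < P.nL := fun i hi => hw i (by simp [hi])
  set B := ((a :: b :: rest).map P.wOf).sum with hBdef
  have hBeq : B = P.wOf a + P.wOf b + (rest.map P.wOf).sum := by simp [hBdef, add_assoc]
  have hvalid : FSt.start.Valid P.Amax P.C P.Cc := ⟨Nat.zero_le _, Nat.zero_le _, Nat.zero_le _, Nat.zero_le _⟩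
  obtain ⟨t, ht, htle⟩ := gameLayer_sound W NB (K - 2) rest FSt.start a b (B - P.wOf a - P.wOf b) hvalid ha hb hrest
    (by simp at hlen; omega) (by omega) (by omega)
  have hab : P.wOf a + P.wOf b ≤ B := by omega
  unfold GameSpec.gameLayer at ht
  obtain ⟨v, hv, hvt⟩ := startOf_le (P.gameArr NB (K - 2)) ha hb hab ht
  -- the certificate says `0 ≤ v`
  unfold GameSpec.gameCert at hc
  simp only [List.all_eq_true] at hc
  have hcB := hc B hBs
  rw [hv, decide_eq_true_eq] at hcB
  -- chain: 0 ≤ v ≤ t ≤ q^K · Lpay · autoE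
  have hpos : (0 : ℝ) < (P.q : ℝ) ^ (K - 2 + 2) * P.Lpay := by
    have hL : (0 : ℝ) < P.Lpay := by exact_mod_cast W.Lpay_pos
    have hq : (0 : ℝ) < P.q := by exact_mod_cast W.q_pos
    positivity
  have h0t : (0 : ℝ) ≤ (t : ℝ) := by exact_mod_cast hcB.trans hvt
  have hprod := h0t.trans htle
  simp only [List.map_cons]
  by_contra hneg
  push Not at hneg
  have : (P.q : ℝ) ^ (K - 2 + 2) * P.Lpay * autoE P.Amax P.C P.Cc P.Kcred FSt.start (P.gOf a :: P.gOf b :: rest.map P.gOf) < 0 :=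
    mul_neg_of_pos_of_neg hpos hneg
  linarith

end Sound

end GameSpec

end Summit.CriticalPhenomena.PercolationContinuityZ3.Theorems.HairyCycle
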